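import Literature.NumberTheory.GaloisRepresentations.ContinuousShapiroLiftMackeyH1Equiv
import Literature.NumberTheory.GaloisRepresentations.ContinuousShapiroOpenCoinducedDescent
import HarnessLib

/-!
# Mackey's decomposition of `Hⁿ(D, Maps(G⧸N, X)|_θ)` in EVERY degree (Brown III (5.6)(b); NSW (1.5.6)–(1.5.7))

Topic `NumberTheory/GaloisRepresentations` (continuous cochain cohomology, Mathlib's `continuousCohomology`);
namespace `Literature.NumberTheory.GaloisRepresentations`.  Definitions with bodies (the Mackey summand
inclusions `Ψ_i` and the all-degree Mackey equivalence) and theorems; NO named fact, no `sorry`, no instance,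
no notation.  Sequel of `ContinuousShapiroLiftMackeyH1Equiv` (module-level Mackey `mackeyCoordEquiv`, its
`H¹` form `mackeyCohomologyEquiv`), `ContinuousShapiroLiftMackeyCup` (`Φ_c = resCoindFinHomR`) and
`ContinuousShapiroOpenCoinducedDescent` §1 (additivity of `Hⁿ(G, –)` in the morphism,
`cohomologyMap_comp_apply_of_sum`).

Setting.  `θ : D →ₜ* G` a continuous homomorphism of topological groups, `N ⊴ G` a NORMAL subgroup,
`N_D := θ⁻¹N = N.comap θ`, `X : TopRep R G` (ANY topological coefficients), `Maps(G ⧸ N, X) = coindFin X N`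
the permutation model of `Ind_N^G Res_N X`, `Φ_c = resCoindFinHomR X N θ c` the Mackey projection onto the
summand of the double coset `θ(D)·c` (`c ∈ G ⧸ N`), and `c : ι → G ⧸ N` representatives of the double cosets
`θ(D) \\ G / N` (`hbij`).  Source followed: K. S. Brown, *Cohomology of Groups* III (5.6)(b)
"`Res_K^G Ind_H^G M ≈ ⊕_{g ∈ E} Ind_{K ∩ gHg⁻¹}^K Res gM`"; Neukirch–Schmidt–Wingberg (1.5.6)–(1.5.7).
The tree had the decomposition at module level (a `D`-equivariant homeomorphic additive equivalence) and on
`H¹` by cocycle transport; this file passes to `Hⁿ` for every `n` by ADDITIVITY of `Hⁿ(D, –)` in the morphism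
(a finite biproduct is preserved): with `Ψ_i := mackeyCoordEquiv⁻¹ ∘ Pi.single i` one has `Φ_{c_j} Ψ_i = δ_{ij}`
and `Σ_i Ψ_i Φ_{c_i} = id`, hence `x = Σ_i Hⁿ(Ψ_i) Hⁿ(Φ_{c_i}) x` on `Hⁿ(D, Maps(G⧸N, X)|_θ)`.

## What is formalised

* §1 `mackeyCoordEquiv_smul` / `_symm_smul` (`R`-linearity), **`mackeySummandIncl i = Ψ_i :
  Maps(D ⧸ N_D, X|_θ) ⟶ Maps(G ⧸ N, X)|_θ`** (a morphism of topological `D`-representations),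
  `resCoindFinHomR_mackeySummandIncl` (`Φ_{c_j} ∘ Ψ_i = δ_{ij}`), `sum_mackeySummandIncl_resCoindFinHomR`
  (`Σ_i Ψ_i ∘ Φ_{c_i} = id`), **`eq_sum_cohomologyMap_mackeySummandIncl`** (`x = Σ_i Hⁿ(Ψ_i) Hⁿ(Φ_{c_i}) x`),
  **`eq_zero_iff_forall_cohomologyMap_resCoindFinHomR_eq_zero`** (a class of the restricted coinduced module
  vanishes iff all its Mackey coordinates do — every degree; degree one is the tree's
  `eq_zero_iff_forall_cohomologyMap_resCoindFinHomR`) and **`mackeyCohomologyEquivDegree n :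
  Hⁿ(D, Maps(G⧸N, X)|_θ) ≃+ Π_i Hⁿ(D, Maps(D⧸N_D, X|_θ))`** (coordinates `Hⁿ(Φ_{c_i})`, inverse `Σ_i Hⁿ(Ψ_i)`).
* §2 bookkeeping for Mathlib's `ContinuousCohomology.map` used by the sequel: `continuousCohomology_map_congr`
  (a map of pairs depends only on the pointwise data), `cohomologyMap_map_id_eq_map`
  (`Hⁿ(f) (θ^* y) = Hⁿ(θ, f) y`), `map_cohomologyMap_eq_map` (`Hⁿ(θ, f) (Hⁿ(e) y) = Hⁿ(θ, e|_θ ≫ f) y`).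

Sequel: `ContinuousShapiroOpenCoinducedMackeyVanishing` (the semi-local vanishing criterion through the local
Shapiro isomorphisms).  Written by the width seat `bsd-line-cf2c-w3` g9 of cell `bsd-print-cf2` (idle-width item
(M7), «Ш-condition transport under restricted Shapiro», planner ruling (N-PT) 2026-08-29).  HONEST FRAMING:
homological algebra only; no arithmetic statement and no case of BSD is proved here.

## References
* K. S. Brown, *Cohomology of Groups*, GTM 87 (1982), III §5 Prop. (5.6)(b). [Brown1982]
* J. Neukirch, A. Schmidt, K. Wingberg, *Cohomology of Number Fields*, 2nd ed. (2008), I §5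
  (1.5.6)–(1.5.7). [NeukirchSchmidtWingberg2008]
* J.-P. Serre, *Galois Cohomology* (1997), I §2.2, §2.4. [SerreGaloisCohomology1997]

## Design notes
* Universes as in `ContinuousShapiroLiftMackeyH1Equiv`: `R : Type u`, `G D : Type v`, `X : TopRep.{v} R G`,
  `continuousCohomology.{u, v, v}`.
* `N` normal throughout (as in the tree's Mackey files): the stabiliser of every coset is `N_D`.
-/

noncomputable section

open CategoryTheory

open scoped Classical

universe u v

namespace Literature.NumberTheory.GaloisRepresentations

open _root_.TopRep

/-! ## §1 Mackey's decomposition on `Hⁿ`, every degree -/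

section MackeyDegree

variable {R : Type u} [CommRing R] [TopologicalSpace R]
variable {G : Type v} [Group G] [TopologicalSpace G]
variable {D : Type v} [Group D] [TopologicalSpace D]
variable (X : TopRep.{v} R G) (N : Subgroup G) [N.Normal] (θ : D →ₜ* G) {ι : Type v} (c : ι → G ⧸ N)
  (hbij : Function.Bijective fun q : ι × (D ⧸ N.comap (θ : D →* G)) => quotientMapOfHom N θ q.2 * c q.1)

/-- `mackeyCoordEquiv` is `R`-linear (each coordinate `Φ_{c_i}` is). [cite: Brown1982, III §5 (5.6)(b)] -/
theorem mackeyCoordEquiv_smul (r : R) (F : TopRep.res (θ : D →* G) (coindFin X N)) :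
    mackeyCoordEquiv X N θ c hbij (r • F) = r • mackeyCoordEquiv X N θ c hbij F := by
  funext i
  rw [Pi.smul_apply, mackeyCoordEquiv_apply, mackeyCoordEquiv_apply, map_smul]

/-- The inverse of `mackeyCoordEquiv` is `R`-linear. [cite: Brown1982, III §5 (5.6)(b)] -/
theorem mackeyCoordEquiv_symm_smul (r : R)
    (Ψ : ι → coindFin (TopRep.res (θ : D →* G) X) (N.comap (θ : D →* G))) :
    (mackeyCoordEquiv X N θ c hbij).symm (r • Ψ) = r • (mackeyCoordEquiv X N θ c hbij).symm Ψ := by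
  apply (mackeyCoordEquiv X N θ c hbij).injective
  rw [AddEquiv.apply_symm_apply, mackeyCoordEquiv_smul, AddEquiv.apply_symm_apply]

/-- **The `i`-th Mackey summand inclusion `Ψ_i : Maps(D⧸N_D, X|_θ) ⟶ Maps(G⧸N, X)|_θ`** (extension by
zero off the `D`-orbit of `c_i`; formally `ψ ↦ mackeyCoordEquiv⁻¹ (Pi.single i ψ)`): a morphism of
topological `D`-representations, the section of the projection `Φ_{c_i}` onto the summand of the double
coset `θ(D)·c_i`. [cite: Brown1982, III §5 (5.6)(b)] [cite: NeukirchSchmidtWingberg2008, I §5 (1.5.6)–(1.5.7)] -/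
def mackeySummandIncl (i : ι) :
    coindFin (TopRep.res (θ : D →* G) X) (N.comap (θ : D →* G)) ⟶ TopRep.res (θ : D →* G) (coindFin X N) :=
  TopRep.ofHom
    { toContinuousLinearMap :=
        { toFun := fun ψ => (mackeyCoordEquiv X N θ c hbij).symm
            (Pi.single (M := fun _ : ι => (coindFin (TopRep.res (θ : D →* G) X) (N.comap (θ : D →* G)) : Type v))
              i ψ)
          map_add' := fun ψ ψ' => by
            rw [← map_add]
            exact congrArg _ (Pi.single_add (f := fun _ : ι =>
              (coindFin (TopRep.res (θ : D →* G) X) (N.comap (θ : D →* G)) : Type v)) i ψ ψ')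
          map_smul' := fun r ψ => by
            rw [RingHom.id_apply, ← mackeyCoordEquiv_symm_smul]
            exact congrArg _ (Pi.single_smul (f := fun _ : ι =>
              (coindFin (TopRep.res (θ : D →* G) X) (N.comap (θ : D →* G)) : Type v)) i r ψ)
          cont := (continuous_mackeyCoordEquiv_symm X N θ c hbij).comp
            (continuous_single (A := fun _ : ι =>
              (coindFin (TopRep.res (θ : D →* G) X) (N.comap (θ : D →* G)) : Type v)) i) }
      isIntertwining' := fun d => by
        ext ψ
        change (mackeyCoordEquiv X N θ c hbij).symm
            (Pi.single (M := fun _ : ι => (coindFin (TopRep.res (θ : D →* G) X) (N.comap (θ : D →* G)) : Type v))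
              i ((coindFin (TopRep.res (θ : D →* G) X) (N.comap (θ : D →* G))).ρ d ψ)) =
          (TopRep.res (θ : D →* G) (coindFin X N)).ρ d ((mackeyCoordEquiv X N θ c hbij).symm
            (Pi.single (M := fun _ : ι => (coindFin (TopRep.res (θ : D →* G) X) (N.comap (θ : D →* G)) : Type v))
              i ψ))
        apply (mackeyCoordEquiv X N θ c hbij).injective
        rw [AddEquiv.apply_symm_apply]
        funext j
        rw [mackeyCoordEquiv_ρ, AddEquiv.apply_symm_apply]
        by_cases h : j = i
        · subst h
          rw [Pi.single_eq_same, Pi.single_eq_same]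
        · rw [Pi.single_eq_of_ne h, Pi.single_eq_of_ne h, map_zero] }

/-- `Φ_{c_j} ∘ Ψ_i = δ_{ij}`: the Mackey projections read the summand inclusions as `Pi.single`.
[cite: Brown1982, III §5 (5.6)(b)] -/
@[simp]
theorem resCoindFinHomR_mackeySummandIncl (i j : ι)
    (ψ : coindFin (TopRep.res (θ : D →* G) X) (N.comap (θ : D →* G))) :
    (resCoindFinHomR X N θ (c j)).hom ((mackeySummandIncl X N θ c hbij i).hom ψ) =
      Pi.single (M := fun _ : ι => (coindFin (TopRep.res (θ : D →* G) X) (N.comap (θ : D →* G)) : Type v))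
        i ψ j := by
  change mackeyCoordEquiv X N θ c hbij ((mackeyCoordEquiv X N θ c hbij).symm (Pi.single
    (M := fun _ : ι => (coindFin (TopRep.res (θ : D →* G) X) (N.comap (θ : D →* G)) : Type v)) i ψ)) j = _
  rw [AddEquiv.apply_symm_apply]

/-- `Σ_i Ψ_i ∘ Φ_{c_i} = id` on `Maps(G⧸N, X)|_θ` (the Mackey decomposition is a finite biproduct).
[cite: Brown1982, III §5 (5.6)(b)] -/
theorem sum_mackeySummandIncl_resCoindFinHomR [Fintype ι] (F : TopRep.res (θ : D →* G) (coindFin X N)) :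
    ∑ i : ι, (mackeySummandIncl X N θ c hbij i).hom ((resCoindFinHomR X N θ (c i)).hom F) = F := by
  change ∑ i : ι, (mackeyCoordEquiv X N θ c hbij).symm (Pi.single
    (M := fun _ : ι => (coindFin (TopRep.res (θ : D →* G) X) (N.comap (θ : D →* G)) : Type v))
    i (mackeyCoordEquiv X N θ c hbij F i)) = F
  rw [← map_sum, Finset.univ_sum_single, AddEquiv.symm_apply_apply]

variable [IsTopologicalGroup D] [Fintype ι]

/-- **Mackey on `Hⁿ`, every degree**: `x = Σ_i Hⁿ(Ψ_i) (Hⁿ(Φ_{c_i}) x)` for every class `x` of the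
restricted coinduced module (additivity of `Hⁿ(D, –)` in the morphism, the tree's
`cohomologyMap_comp_apply_of_sum`). [cite: Brown1982, III §5 (5.6)(b)] [cite: NeukirchSchmidtWingberg2008, I §5 (1.5.6)–(1.5.7)] -/
theorem eq_sum_cohomologyMap_mackeySummandIncl (n : ℕ)
    (x : continuousCohomology.{u, v, v} n (TopRep.res (θ : D →* G) (coindFin X N))) :
    x = ∑ i : ι, cohomologyMap (mackeySummandIncl X N θ c hbij i) n
      (cohomologyMap (resCoindFinHomR X N θ (c i)) n x) := by
  have h := cohomologyMap_comp_apply_of_sum (𝟙 _) (𝟙 _) Finset.univ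
    (fun i => resCoindFinHomR X N θ (c i) ≫ mackeySummandIncl X N θ c hbij i)
    (fun F => by
      rw [TopRep.id_apply, TopRep.id_apply]
      exact ((sum_mackeySummandIncl_resCoindFinHomR X N θ c hbij F).symm).trans
        (Finset.sum_congr rfl fun i _ => (TopRep.comp_apply _ _ _).symm)) n x
  rw [cohomologyMap_id_apply, cohomologyMap_id_apply] at h
  refine h.trans (Finset.sum_congr rfl fun i _ => ?_)
  exact (cohomologyMap_comp_apply_of_eq _ _ _ (fun F => (TopRep.comp_apply _ _ _).symm) n x).symm

include hbij in
/-- **Vanishing criterion, coordinate form, every degree**: a class of the restricted coinduced module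
vanishes iff all its Mackey coordinates `Hⁿ(Φ_{c_i}) x` do (the degree-one case is the tree's
`eq_zero_iff_forall_cohomologyMap_resCoindFinHomR`). [cite: NeukirchSchmidtWingberg2008, I §5 (1.5.6)–(1.5.7)] -/
theorem eq_zero_iff_forall_cohomologyMap_resCoindFinHomR_eq_zero (n : ℕ)
    (x : continuousCohomology.{u, v, v} n (TopRep.res (θ : D →* G) (coindFin X N))) :
    x = 0 ↔ ∀ i, cohomologyMap (resCoindFinHomR X N θ (c i)) n x = 0 := by
  refine ⟨fun hx i => by rw [hx, map_zero], fun h => ?_⟩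
  rw [eq_sum_cohomologyMap_mackeySummandIncl X N θ c hbij n x]
  exact Finset.sum_eq_zero fun i _ => by rw [h i, map_zero]

/-- **Mackey's decomposition `Hⁿ(D, Maps(G⧸N, X)|_θ) ≃+ Π_i Hⁿ(D, Maps(D⧸N_D, X|_θ))` in every degree**
(coordinates `Hⁿ(Φ_{c_i})`, inverse `Σ_i Hⁿ(Ψ_i)`); the degree-one case is the tree's
`mackeyCohomologyEquiv`. [cite: Brown1982, III §5 (5.6)(b)] [cite: NeukirchSchmidtWingberg2008, I §5 (1.5.6)–(1.5.7)] -/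
def mackeyCohomologyEquivDegree (n : ℕ) :
    continuousCohomology.{u, v, v} n (TopRep.res (θ : D →* G) (coindFin X N)) ≃+
      (ι → continuousCohomology.{u, v, v} n (coindFin (TopRep.res (θ : D →* G) X) (N.comap (θ : D →* G)))) where
  toFun x i := cohomologyMap (resCoindFinHomR X N θ (c i)) n x
  invFun t := ∑ i : ι, cohomologyMap (mackeySummandIncl X N θ c hbij i) n (t i)
  left_inv x := (eq_sum_cohomologyMap_mackeySummandIncl X N θ c hbij n x).symm
  right_inv t := by
    funext j
    change cohomologyMap (resCoindFinHomR X N θ (c j)) n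
      (∑ i : ι, cohomologyMap (mackeySummandIncl X N θ c hbij i) n (t i)) = t j
    rw [map_sum, Finset.sum_eq_single j]
    · rw [cohomologyMap_comp_apply_of_eq _ _ (𝟙 _) (fun ψ => by
        rw [resCoindFinHomR_mackeySummandIncl, Pi.single_eq_same, TopRep.id_apply]) n (t j),
        cohomologyMap_id_apply]
    · intro i _ hij
      exact cohomologyMap_comp_apply_of_zero _ _ (fun ψ => by
        rw [resCoindFinHomR_mackeySummandIncl, Pi.single_eq_of_ne (Ne.symm hij)]) n (t i)
    · intro hj
      exact absurd (Finset.mem_univ j) hj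
  map_add' x y := funext fun i => map_add _ x y

/-- Coordinates of `mackeyCohomologyEquivDegree`. [cite: Brown1982, III §5 (5.6)(b)] -/
@[simp]
theorem mackeyCohomologyEquivDegree_apply (n : ℕ)
    (x : continuousCohomology.{u, v, v} n (TopRep.res (θ : D →* G) (coindFin X N))) (i : ι) :
    mackeyCohomologyEquivDegree X N θ c hbij n x i = cohomologyMap (resCoindFinHomR X N θ (c i)) n x :=
  rfl

end MackeyDegree

/-! ## §2 Bookkeeping for `ContinuousCohomology.map`: congruence, the scalar-free transport along the
identity, and `Hⁿ(f) ∘ θ^* = Hⁿ(θ, f)` -/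

section Bookkeeping

variable {R : Type u} [CommRing R] [TopologicalSpace R]
variable {G : Type v} [Group G] [TopologicalSpace G] [IsTopologicalGroup G]
variable {D : Type v} [Group D] [TopologicalSpace D] [IsTopologicalGroup D]

/-- `ContinuousCohomology.map` only depends on the pair (group homomorphism, pointwise module map).
[cite: SerreGaloisCohomology1997, I §2.4] -/
theorem continuousCohomology_map_congr {X : TopRep.{v} R G} {Y : TopRep.{v} R D}
    {φ φ' : D →ₜ* G} (h : φ = φ') (f : TopRep.res (φ : D →* G) X ⟶ Y)
    (f' : TopRep.res (φ' : D →* G) X ⟶ Y) (hff' : ∀ x : X, f.hom x = f'.hom x) (n : ℕ) :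
    ContinuousCohomology.map φ f n = ContinuousCohomology.map φ' f' n := by
  subst h
  have : f = f' := TopRep.hom_ext (ContIntertwiningMap.ext (ContinuousLinearMap.ext fun x => hff' x))
  rw [this]

/-- **`Hⁿ(f) (θ^* y) = Hⁿ(θ, f) y`**: a morphism `f : X|_θ ⟶ Y` of `D`-representations applied after the
restriction `θ^* = Hⁿ(θ, 𝟙)` is the map of pairs `Hⁿ(θ, f)` (Mathlib `ContinuousCohomology.map_comp`; the
degree-one cocycle form is the tree's `cohomologyMap_resCoindFinHomR_map_id`). [cite: SerreGaloisCohomology1997, I §2.4] -/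
theorem cohomologyMap_map_id_eq_map (X : TopRep.{v} R G) {Y : TopRep.{v} R D} (θ : D →ₜ* G)
    (f : TopRep.res (θ : D →* G) X ⟶ Y) (n : ℕ) (y : continuousCohomology.{u, v, v} n X) :
    cohomologyMap f n ((ContinuousCohomology.map θ (𝟙 (TopRep.res (θ : D →* G) X)) n).hom y) =
      (ContinuousCohomology.map θ f n).hom y := by
  have hc := ContinuousCohomology.map_comp θ (ContinuousMonoidHom.id D) (X := X)
    (Y := TopRep.res (θ : D →* G) X) (Z := Y) (𝟙 _) (resIdHom f) n
  have hθ : θ.comp (ContinuousMonoidHom.id D) = θ := ContinuousMonoidHom.ext fun _ => rfl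
  have key : ContinuousCohomology.map (θ.comp (ContinuousMonoidHom.id D)) (X := X)
      ((TopRep.resFunctor ((ContinuousMonoidHom.id D : D →ₜ* D) : D →* D)).map
        (𝟙 (TopRep.res (θ : D →* G) X)) ≫ resIdHom f) n = ContinuousCohomology.map θ f n :=
    continuousCohomology_map_congr hθ _ f (fun _ => rfl) n
  exact (congrArg (fun T => T.hom y) (key.symm.trans hc)).symm

/-- **`Hⁿ(θ, f ≫ g)`-type splitting on the SOURCE side**: `Hⁿ(θ, f) (Hⁿ(e) y) = Hⁿ(θ, e|_θ ≫ f) y` for an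
endomorphism-side morphism `e : X ⟶ X'` of `G`-representations. [cite: SerreGaloisCohomology1997, I §2.4] -/
theorem map_cohomologyMap_eq_map {X X' : TopRep.{v} R G} {Y : TopRep.{v} R D} (θ : D →ₜ* G)
    (e : X ⟶ X') (f : TopRep.res (θ : D →* G) X' ⟶ Y) (n : ℕ) (y : continuousCohomology.{u, v, v} n X) :
    (ContinuousCohomology.map θ f n).hom (cohomologyMap e n y) =
      (ContinuousCohomology.map θ ((TopRep.resFunctor (θ : D →* G)).map e ≫ f) n).hom y := by
  have hc := ContinuousCohomology.map_comp (ContinuousMonoidHom.id G) θ (X := X) (Y := X') (Z := Y)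
    (resIdHom e) f n
  have hθ : (ContinuousMonoidHom.id G).comp θ = θ := ContinuousMonoidHom.ext fun _ => rfl
  have key : ContinuousCohomology.map ((ContinuousMonoidHom.id G).comp θ) (X := X)
      ((TopRep.resFunctor (θ : D →* G)).map (resIdHom e) ≫ f) n =
      ContinuousCohomology.map θ ((TopRep.resFunctor (θ : D →* G)).map e ≫ f) n :=
    continuousCohomology_map_congr hθ _ _ (fun _ => rfl) n
  exact (congrArg (fun T => T.hom y) (key.symm.trans hc)).symm

end Bookkeeping

end Literature.NumberTheory.GaloisRepresentations

end
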